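import Mathlib
import Summits.Ventures.HodgeRepro.Tier3IwasawaFiniteLevel

/-!
# Tier3IwasawaLevelQuotient — the Iwasawa dictionary R-B.3 at FINITE LEVEL, power-series half: `O⟦X⟧/(h_n) ≅ O[X]/(h_n)
≅ O[Γ_n]` and «evaluation of `G` at `ν` is `G(ζ_ν − 1)`» computed at level `n`

Blind re-derivation cell `pub-hodge-repro`, seat `t3-p3` (Tier 3, T3.2 «(R2) ∧ (R1) — the pinning»; T3.5 Lean item beside
it). Target tree path `lean/Summits/Ventures/HodgeRepro/Tier3IwasawaLevelQuotient.lean`; imports Mathlib and the cell's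
`Tier3IwasawaFiniteLevel` (t3-p3 g16: `O[X]/((X+1)^m − 1) ≅ O[Γ_m]` with `1 + X ↦ γ`, and `(lift ν)(mk Q) = Q(ν(γ) − 1)`);
theorems only (no definition, instance, notation or macro).

WHAT THIS FILE STATES. Lang, *Cyclotomic Fields I and II* (GTM 121), Ch. 5 §1 (p. 124): for `Γ ≅ ℤ_p` with generator
`γ`, `Γ_n = Γ/Γ^{p^n}`, `h_n = (1 + X)^{p^n} − 1` («such a polynomial is called distinguished»), Theorem 1.1: `Λ = ℤ_p⟦X⟧ →
lim ℤ_p[X]/(h_n)` is an isomorphism, i.e. `ℤ_p⟦Γ⟧ ≅ ℤ_p⟦X⟧` via `γ ↦ 1 + X`; Ch. 4 §1 Thm 1.2 / Meas 2 (p. 95 ff.): the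
power series `G` of a measure evaluates at the character `ν` (`ζ_ν := ν(γ)` a `p`-power root of unity) to `G(ζ_ν − 1)`
(t3-p4's `R-B3-DICTIONARY.md` §1 / §3; the lane's `R2-PINNING-ADDENDUM-7` §A31 (6) lists this dictionary among what stays
on paper). `Tier3IwasawaFiniteLevel` put the GROUP-RING half of the `n`-th term on the kernel; this file is the
POWER-SERIES half of the same term, on Mathlib's Weierstrass division:

* `coeff_X_add_one_pow_sub_one_zero`, `coeff_X_add_one_pow_sub_one_of_pos`, `natDegree_X_add_one_pow`,
  `monic_X_add_one_pow_sub_one`, `natDegree_X_add_one_pow_sub_one` — the coefficients, monicity and degree of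
  `h_m = (X + 1)^m − 1`;
* `isDistinguishedAt_X_add_one_pow_prime_pow_sub_one` — **`h_n` is distinguished** at any ideal containing `p`
  (Lang's «such a polynomial is called distinguished»: `p ∣ C(p^n, k)` for `0 < k < p^n`, `Nat.Prime.dvd_choose_pow`);
* `exists_algEquiv_quotient_X_add_one_pow_prime_pow_sub_one` — **`O⟦X⟧/(h_n) ≅ O[X]/(h_n)`** over an adically complete
  local ring with `p` in the maximal ideal, the isomorphism being the identity on polynomials (Mathlib's Weierstrass
  division `Polynomial.IsDistinguishedAt.algEquivQuotient`, read backwards) — the `n`-th term of Lang's Theorem 1.1;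
* `exists_algEquiv_quotient_monoidAlgebra` — composed with the group-ring half: **`O⟦X⟧/(h_n) ≅ O[Γ_n]`** with
  `1 + X ↦ γ` on polynomials (Lang's «ℤ_p[X]/(h_n)» read as the group ring of `Γ_n`);
* `aeval_eq_aeval_weierstrassMod_of_aeval_eq_zero` — evaluation of a power series `f` at a topologically nilpotent root
  `z` of a distinguished `h` is the evaluation of the polynomial remainder `f %ʷ h` at `z` (`f = h · q + r`);
* `aeval_sub_one_eq_aeval_weierstrassMod_of_pow_eq_one` — at `z = ζ − 1` with `ζ^{p^n} = 1`: **`f(ζ − 1) = (f mod h_n)(ζ − 1)`**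
  — «evaluation of `G` at `ν` is `G(ζ_ν − 1)`» computed at level `n`;
* `lift_liftAlgHom_mk_weierstrassMod_eq_aeval` — the dictionary sentence at level `n` with the POWER SERIES on the left:
  a character `ν` of `Γ_n` applied to the image of `f` in `O[Γ_n]` (through `O⟦X⟧ → O[X]/(h_n) ≅ O[Γ_n]`) is `f(ν(γ) − 1)`.

HONESTY. What stays on the page: the projective LIMIT `O⟦Γ⟧ = lim O[Γ_n] ≅ O⟦X⟧` (Lang Thm 1.1 itself — Mathlib has no
completed group algebra; here only its `n`-th term), measures ↔ power series (Thm 1.2 / Meas 2), the Katz measure, the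
interpolation formula, and every printed theorem of R-B. The ring `O` is any adically complete local ring with `p` in its
maximal ideal (Lang: the ring of integers of a `p`-adic field), the value ring `B` any complete linearly topologised
`O`-algebra (Lang: `𝔬[ζ]`; the lane instantiates `𝓞_ℂ_[p]`). No verdict / residue / label / row of route/TIER3.md §3
moves (R-B.3 stays CLOSED on Lang; R-B stays DECLARED). HC_CM is NOT proved by anyone in this repository.
-/

set_option autoImplicit false

open Polynomial
open scoped PowerSeries

namespace Summit.Ventures.HodgeRepro.T3.R2Pinning

/-! ### §1 `h_m = (X + 1)^m − 1`: coefficients, monicity, and distinguishedness for `m = p^n` -/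

section Distinguished

variable {A : Type*} [CommRing A]

/-- The constant coefficient of `(X + 1)^m − 1` is `0`. -/
theorem coeff_X_add_one_pow_sub_one_zero (m : ℕ) : ((X + 1) ^ m - 1 : A[X]).coeff 0 = 0 := by
  simp [Polynomial.coeff_X_add_one_pow]

/-- For `k > 0` the `k`-th coefficient of `(X + 1)^m − 1` is the binomial coefficient `C(m, k)`. -/
theorem coeff_X_add_one_pow_sub_one_of_pos (m : ℕ) {k : ℕ} (hk : 0 < k) :
    ((X + 1) ^ m - 1 : A[X]).coeff k = (m.choose k : A) := by
  rw [Polynomial.coeff_sub, Polynomial.coeff_X_add_one_pow, Polynomial.coeff_one, if_neg hk.ne', sub_zero]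

/-- `(X + 1)^m` is monic of degree `m` (as `X + C 1`). -/
theorem natDegree_X_add_one_pow [Nontrivial A] (m : ℕ) : ((X + 1 : A[X]) ^ m).natDegree = m := by
  simpa using Polynomial.natDegree_pow_X_add_C (R := A) m 1

/-- `(X + 1)^m − 1` is monic for `m ≠ 0`. -/
theorem monic_X_add_one_pow_sub_one [Nontrivial A] {m : ℕ} (hm : m ≠ 0) : ((X + 1) ^ m - 1 : A[X]).Monic := by
  have h1 : ((X + 1 : A[X]) ^ m).Monic := by
    simpa using (Polynomial.monic_X_add_C (1 : A)).pow m
  refine h1.sub_of_left ?_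
  rw [Polynomial.degree_one, Polynomial.degree_eq_natDegree h1.ne_zero, natDegree_X_add_one_pow]
  exact_mod_cast Nat.pos_of_ne_zero hm

/-- `(X + 1)^m − 1` has degree `m` for `m ≠ 0`. -/
theorem natDegree_X_add_one_pow_sub_one [Nontrivial A] {m : ℕ} (hm : m ≠ 0) :
    ((X + 1) ^ m - 1 : A[X]).natDegree = m := by
  rw [Polynomial.natDegree_sub_eq_left_of_natDegree_lt, natDegree_X_add_one_pow]
  rw [Polynomial.natDegree_one, natDegree_X_add_one_pow]
  exact Nat.pos_of_ne_zero hm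

/-- **`h_n = (X + 1)^{p^n} − 1` is distinguished** at every ideal `I ∋ p`: it is monic of degree `p^n`, its constant
coefficient is `0`, and its other lower coefficients `C(p^n, k)` (`0 < k < p^n`) are multiples of `p`
(`Nat.Prime.dvd_choose_pow`) — Lang's «such a polynomial is called distinguished» (GTM 121 p. 124). -/
theorem isDistinguishedAt_X_add_one_pow_prime_pow_sub_one [Nontrivial A] {p : ℕ} (hp : p.Prime) {I : Ideal A}
    (hpI : (p : A) ∈ I) (n : ℕ) : ((X + 1) ^ p ^ n - 1 : A[X]).IsDistinguishedAt I := by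
  have hm : p ^ n ≠ 0 := pow_ne_zero n hp.ne_zero
  refine ⟨⟨fun {k} hk => ?_⟩, monic_X_add_one_pow_sub_one hm⟩
  rw [natDegree_X_add_one_pow_sub_one hm] at hk
  rcases Nat.eq_zero_or_pos k with rfl | hk0
  · rw [coeff_X_add_one_pow_sub_one_zero]; exact I.zero_mem
  · rw [coeff_X_add_one_pow_sub_one_of_pos _ hk0]
    obtain ⟨c, hc⟩ := hp.dvd_choose_pow hk0.ne' hk.ne
    rw [hc, Nat.cast_mul]
    exact I.mul_mem_right _ hpI

end Distinguished

/-! ### §2 The `n`-th term of Lang's Theorem 1.1: `O⟦X⟧/(h_n) ≅ O[X]/(h_n) ≅ O[Γ_n]` -/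

section Quotient

variable {A : Type*} [CommRing A] [IsLocalRing A] [IsAdicComplete (IsLocalRing.maximalIdeal A) A]

/-- **`O⟦X⟧/(h_n) ≅ O[X]/(h_n)`**, the identity on polynomials: over an adically complete local ring with `p` in its
maximal ideal, Weierstrass division by the distinguished `h_n = (X + 1)^{p^n} − 1` identifies the power-series quotient
with the polynomial quotient (Mathlib's `Polynomial.IsDistinguishedAt.algEquivQuotient`, read backwards) — the `n`-th
term of Lang's «`Λ = ℤ_p⟦X⟧ → lim ℤ_p[X]/(h_n)` is an isomorphism» (GTM 121 Ch. 5 §1 Thm 1.1). -/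
theorem exists_algEquiv_quotient_X_add_one_pow_prime_pow_sub_one {p : ℕ} (hp : p.Prime)
    (hpm : (p : A) ∈ IsLocalRing.maximalIdeal A) (n : ℕ) :
    ∃ e : (A⟦X⟧ ⧸ Ideal.span {(((X + 1) ^ p ^ n - 1 : A[X]) : A⟦X⟧)}) ≃ₐ[A]
        (A[X] ⧸ Ideal.span {((X + 1) ^ p ^ n - 1 : A[X])}),
      ∀ P : A[X], e (Ideal.Quotient.mk _ (P : A⟦X⟧)) = Ideal.Quotient.mk _ P := by
  have hd := isDistinguishedAt_X_add_one_pow_prime_pow_sub_one hp hpm n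
  refine ⟨hd.algEquivQuotient.symm, fun P => ?_⟩
  rw [AlgEquiv.symm_apply_eq]
  simp [Polynomial.IsDistinguishedAt.algEquivQuotient]

/-- **`O⟦X⟧/(h_n) ≅ O[Γ_n]`** with `1 + X ↦ γ` on polynomials — the `n`-th term of the Iwasawa dictionary
`O⟦Γ⟧ ≅ O⟦X⟧` (Lang's «`ℤ_p[X]/(h_n)`» read as the group ring of `Γ_n = Γ/Γ^{p^n}` through `Tier3IwasawaFiniteLevel`). -/
theorem exists_algEquiv_quotient_monoidAlgebra {p : ℕ} (hp : p.Prime)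
    (hpm : (p : A) ∈ IsLocalRing.maximalIdeal A) (n : ℕ) :
    ∃ e : (A⟦X⟧ ⧸ Ideal.span {(((X + 1) ^ p ^ n - 1 : A[X]) : A⟦X⟧)}) ≃ₐ[A]
        MonoidAlgebra A (Multiplicative (ZMod (p ^ n))),
      ∀ P : A[X], e (Ideal.Quotient.mk _ (P : A⟦X⟧)) =
        AdjoinRoot.liftAlgHom ((X + 1) ^ p ^ n - 1)
          (Algebra.ofId A (MonoidAlgebra A (Multiplicative (ZMod (p ^ n)))))
          (MonoidAlgebra.of A (Multiplicative (ZMod (p ^ n))) (Multiplicative.ofAdd 1) - 1)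
          (eval₂_of_ofAdd_one_sub_one A (p ^ n)) (AdjoinRoot.mk _ P) := by
  haveI : NeZero (p ^ n) := ⟨pow_ne_zero n hp.ne_zero⟩
  obtain ⟨e₁, he₁⟩ := exists_algEquiv_quotient_X_add_one_pow_prime_pow_sub_one (A := A) hp hpm n
  refine ⟨e₁.trans (AlgEquiv.ofBijective _ (liftAlgHom_X_add_one_pow_sub_one_bijective A (p ^ n))), fun P => ?_⟩
  simp only [AlgEquiv.trans_apply, AlgEquiv.coe_ofBijective, he₁]
  rfl

end Quotient

/-! ### §3 «Evaluation of `G` at `ν` is `G(ζ_ν − 1)`», computed at level `n` -/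

section Evaluation

variable {A : Type*} [CommRing A] [IsLocalRing A] [IsAdicComplete (IsLocalRing.maximalIdeal A) A]
  [UniformSpace A] [IsUniformAddGroup A] [IsTopologicalRing A]
variable {B : Type*} [CommRing B] [UniformSpace B] [IsUniformAddGroup B] [T2Space B]
  [CompleteSpace B] [IsTopologicalRing B] [IsLinearTopology B B] [Algebra A B] [ContinuousSMul A B]

/-- **Evaluation at a root of the divisor factors through the Weierstrass remainder**: for a distinguished `h` and a
topologically nilpotent `z` with `h(z) = 0`, `f(z) = (f mod h)(z)` — `f = h · q + r` evaluated at `z`. -/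
theorem aeval_eq_aeval_weierstrassMod_of_aeval_eq_zero {h : A[X]}
    (hd : h.IsDistinguishedAt (IsLocalRing.maximalIdeal A)) {z : B} (hz : PowerSeries.HasEval z)
    (hroot : Polynomial.aeval z h = 0) (f : A⟦X⟧) :
    PowerSeries.aeval hz f = Polynomial.aeval z (PowerSeries.weierstrassMod f (h : A⟦X⟧)) := by
  have h1 : PowerSeries.constantCoeff (1 : A⟦X⟧) ∉ IsLocalRing.maximalIdeal A := by
    rw [map_one]
    exact (Ideal.ne_top_iff_one _).1 (IsLocalRing.maximalIdeal.isMaximal A).ne_top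
  have hg : (h : A⟦X⟧).map (IsLocalRing.residue A) ≠ 0 :=
    hd.map_ne_zero_of_eq_mul (h : A⟦X⟧) 1 h1 (mul_one _).symm
  have hdiv := PowerSeries.eq_mul_weierstrassDiv_add_weierstrassMod f hg
  conv_lhs => rw [hdiv]
  rw [map_add, map_mul, PowerSeries.aeval_coe, PowerSeries.aeval_coe, hroot, zero_mul, zero_add]

/-- **`f(ζ − 1) = (f mod h_n)(ζ − 1)` for `ζ^{p^n} = 1`**: the value of a power series at `ζ_ν − 1` is computed by its
polynomial remainder modulo `h_n = (X + 1)^{p^n} − 1` — «evaluation of `G` at `ν` is `G(ζ_ν − 1)`» at level `n`. -/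
theorem aeval_sub_one_eq_aeval_weierstrassMod_of_pow_eq_one {p : ℕ} (hp : p.Prime)
    (hpm : (p : A) ∈ IsLocalRing.maximalIdeal A) (n : ℕ) {ζ : B} (hζ : ζ ^ p ^ n = 1)
    (hz : PowerSeries.HasEval (ζ - 1)) (f : A⟦X⟧) :
    PowerSeries.aeval hz f =
      Polynomial.aeval (ζ - 1) (PowerSeries.weierstrassMod f (((X + 1) ^ p ^ n - 1 : A[X]) : A⟦X⟧)) :=
  aeval_eq_aeval_weierstrassMod_of_aeval_eq_zero (isDistinguishedAt_X_add_one_pow_prime_pow_sub_one hp hpm n) hz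
    (by simp [hζ]) f

/-- **The dictionary sentence at level `n`, power series on the left**: a character `ν` of `Γ_n` applied to the image of
`f ∈ O⟦X⟧` in `O[Γ_n]` (through `O⟦X⟧ → O[X]/(h_n) ≅ O[Γ_n]`, `1 + X ↦ γ`) is `f(ν(γ) − 1)` — Lang's «`∫ ν dμ_G = G(ζ_ν − 1)`»
read at the finite level, with the topological nilpotence of `ζ_ν − 1` as the hypothesis `hz`. -/
theorem lift_liftAlgHom_mk_weierstrassMod_eq_aeval {p : ℕ} (hp : p.Prime)
    (hpm : (p : A) ∈ IsLocalRing.maximalIdeal A) (n : ℕ) (ν : Multiplicative (ZMod (p ^ n)) →* B)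
    (hz : PowerSeries.HasEval (ν (Multiplicative.ofAdd 1) - 1)) (f : A⟦X⟧) :
    (MonoidAlgebra.lift A B (Multiplicative (ZMod (p ^ n))) ν)
      (AdjoinRoot.liftAlgHom ((X + 1) ^ p ^ n - 1)
        (Algebra.ofId A (MonoidAlgebra A (Multiplicative (ZMod (p ^ n)))))
        (MonoidAlgebra.of A (Multiplicative (ZMod (p ^ n))) (Multiplicative.ofAdd 1) - 1)
        (eval₂_of_ofAdd_one_sub_one A (p ^ n))
        (AdjoinRoot.mk _ (PowerSeries.weierstrassMod f (((X + 1) ^ p ^ n - 1 : A[X]) : A⟦X⟧)))) =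
      PowerSeries.aeval hz f := by
  rw [lift_liftAlgHom_mk_X_add_one_pow_sub_one,
    aeval_sub_one_eq_aeval_weierstrassMod_of_pow_eq_one hp hpm n (monoidHom_ofAdd_one_pow ν) hz]

end Evaluation

end Summit.Ventures.HodgeRepro.T3.R2Pinning
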